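import Summits.HubbardSuperconductivity.HubbardSuperconductivity.Theorems.AnisotropyChordSpinMonotoneTwoMagnonSymmetric
import Literature.Combinatorics.SimpleGraph.LovaszThetaComplement
import Mathlib.Combinatorics.SimpleGraph.Prod

/-!
# Route `AnisotropyChord`: the rook graph `K_m □ K_n` — automorphisms, the three pair classes,
# and class sums (combinatorial toolkit for the two-magnon rung TM-VT on a two-contact-orbit family)

The rook graph on `α × β` (`(a,b) ∼ (a',b')` iff the two sites agree in exactly one coordinate;
`= ⊤ □ ⊤`, the line graph of `K_{|α|,|β|}`, the Cayley graph of `ℤ_m × ℤ_n` generated by the two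
axes) is connected and vertex-transitive (`rook_connected`, `rook_isVertexTransitive`: coordinate
permutations `Equiv.prodCongr e₁ e₂` are automorphisms, `rook_adj_prodCongr`), but for `|α| ≠ |β|`
it is NOT edge-transitive: unordered pairs of distinct sites fall into THREE `Aut`-classes — row
pairs (same second coordinate; edges of the `K_{|α|}` factors), column pairs (same first coordinate;
edges of the `K_{|β|}` factors) and far pairs (non-adjacent).  A two-magnon vector fixed by all
automorphisms is therefore constant on each class (`rowPair_eq`, `colPair_eq`, `farPair_eq`, from
two-point transitivity of the symmetric group, `exists_perm_apply_pair`), and the neighbour sums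
that enter `H(Δ)` in pair coordinates (`xxz_mulVec_pair`) are explicit class counts
(`rook_sum_adj`, `hopSum_eq_two_mul`, `sum_pairs_of_classes` here; the per-class neighbour sums in
`…TwoMagnonRookHopping`).  Companion files: `…TwoMagnonRookOverlap` (real analysis) and
`…TwoMagnonRook` (the rung).  No definition is introduced.
-/

set_option linter.dupNamespace false

noncomputable section

namespace Summit.HubbardSuperconductivity.HubbardSuperconductivity.Theorems.AnisotropyChord.TwoMagnon

open Matrix Complex Finset
open Literature.Combinatorics.SimpleGraph (IsVertexTransitive)

variable {α β : Type*} [Fintype α] [DecidableEq α] [Fintype β] [DecidableEq β]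

/-! ### Two-point transitivity of the symmetric group -/

omit [Fintype α] in
/-- The symmetric group is `2`-transitive: `a ≠ b`, `c ≠ d` ⇒ some permutation maps `a ↦ c`,
`b ↦ d`. [folklore] -/
theorem exists_perm_apply_pair {a b c d : α} (hab : a ≠ b) (hcd : c ≠ d) :
    ∃ e : α ≃ α, e a = c ∧ e b = d := by
  refine ⟨(Equiv.swap a c).trans (Equiv.swap (Equiv.swap a c b) d), ?_, ?_⟩
  · rw [Equiv.trans_apply, Equiv.swap_apply_left]
    apply Equiv.swap_apply_of_ne_of_ne _ hcd
    intro h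
    have h' : Equiv.swap a c a = Equiv.swap a c b := by rw [Equiv.swap_apply_left]; exact h
    exact hab ((Equiv.swap a c).injective h')
  · rw [Equiv.trans_apply, Equiv.swap_apply_left]

/-! ### The rook graph: automorphisms, vertex-transitivity, connectedness -/

section Rook

variable {G : SimpleGraph (α × β)}

omit [Fintype α] [DecidableEq α] [Fintype β] [DecidableEq β] in
/-- Coordinate permutations are automorphisms of the rook graph. [folklore] -/
theorem rook_adj_prodCongr
    (hadj : ∀ x y : α × β, G.Adj x y ↔ (x.1 ≠ y.1 ∧ x.2 = y.2) ∨ (x.1 = y.1 ∧ x.2 ≠ y.2))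
    (e₁ : α ≃ α) (e₂ : β ≃ β) (x y : α × β) :
    G.Adj (Equiv.prodCongr e₁ e₂ x) (Equiv.prodCongr e₁ e₂ y) ↔ G.Adj x y := by
  rw [hadj, hadj]
  simp only [Equiv.prodCongr_apply, Prod.map_fst, Prod.map_snd, ne_eq, e₁.apply_eq_iff_eq,
    e₂.apply_eq_iff_eq]

omit [Fintype α] [DecidableEq α] [Fintype β] [DecidableEq β] in
/-- `prodCongr e₁ e₂ (a, b) = (e₁ a, e₂ b)`. [folklore] -/
theorem prodCongr_apply_mk (e₁ : α ≃ α) (e₂ : β ≃ β) (x : α × β) :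
    Equiv.prodCongr e₁ e₂ x = (e₁ x.1, e₂ x.2) := by
  rw [Equiv.prodCongr_apply]
  rfl

omit [Fintype α] [Fintype β] in
/-- **The rook graph is vertex-transitive** (product of two transpositions). [folklore] -/
theorem rook_isVertexTransitive
    (hadj : ∀ x y : α × β, G.Adj x y ↔ (x.1 ≠ y.1 ∧ x.2 = y.2) ∨ (x.1 = y.1 ∧ x.2 ≠ y.2)) :
    IsVertexTransitive G := by
  intro x y
  refine ⟨{ toEquiv := Equiv.prodCongr (Equiv.swap x.1 y.1) (Equiv.swap x.2 y.2),
            map_rel_iff' := fun {a b} => rook_adj_prodCongr hadj _ _ a b }, ?_⟩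
  show Equiv.prodCongr (Equiv.swap x.1 y.1) (Equiv.swap x.2 y.2) x = y
  rw [prodCongr_apply_mk, Equiv.swap_apply_left, Equiv.swap_apply_left]

omit [Fintype α] [DecidableEq α] [Fintype β] [DecidableEq β] in
/-- **The rook graph is connected** (it is `⊤ □ ⊤`). [folklore] -/
theorem rook_connected [Nonempty α] [Nonempty β]
    (hadj : ∀ x y : α × β, G.Adj x y ↔ (x.1 ≠ y.1 ∧ x.2 = y.2) ∨ (x.1 = y.1 ∧ x.2 ≠ y.2)) :
    G.Connected := by
  have hG : G = (⊤ : SimpleGraph α) □ (⊤ : SimpleGraph β) := by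
    ext x y
    rw [hadj x y, SimpleGraph.boxProd_adj, SimpleGraph.top_adj, SimpleGraph.top_adj]
    tauto
  rw [hG]
  exact SimpleGraph.Connected.boxProd SimpleGraph.connected_top SimpleGraph.connected_top

/-! ### Invariant vectors are constant on the three pair classes -/

variable {f : (α × β → Fin 2) → ℂ}

omit [Fintype α] [Fintype β] in
/-- An automorphism-invariant vector takes the same value on a pair and on its image. [folklore] -/
theorem apply_pair_eq_of_aut
    (hfix : ∀ π : α × β ≃ α × β, (∀ x y, G.Adj (π x) (π y) ↔ G.Adj x y) → ∀ σ, f (σ ∘ π) = f σ)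
    (π : α × β ≃ α × β) (hπ : ∀ x y, G.Adj (π x) (π y) ↔ G.Adj x y) (i j : α × β) :
    f (Pi.single i 1 + Pi.single j 1) = f (Pi.single (π i) 1 + Pi.single (π j) 1) := by
  have h := hfix π hπ (Pi.single (π i) 1 + Pi.single (π j) 1)
  rw [pair_comp_equiv, Equiv.symm_apply_apply, Equiv.symm_apply_apply] at h
  exact h

omit [Fintype α] [Fintype β] in
/-- **Row pairs form one class**: an invariant vector takes one value on all pairs with equal
second and distinct first coordinates. [folklore] -/
theorem rowPair_eq
    (hadj : ∀ x y : α × β, G.Adj x y ↔ (x.1 ≠ y.1 ∧ x.2 = y.2) ∨ (x.1 = y.1 ∧ x.2 ≠ y.2))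
    (hfix : ∀ π : α × β ≃ α × β, (∀ x y, G.Adj (π x) (π y) ↔ G.Adj x y) → ∀ σ, f (σ ∘ π) = f σ)
    {i j i' j' : α × β} (h1 : i.1 ≠ j.1) (h2 : i.2 = j.2) (h1' : i'.1 ≠ j'.1) (h2' : i'.2 = j'.2) :
    f (Pi.single i 1 + Pi.single j 1) = f (Pi.single i' 1 + Pi.single j' 1) := by
  obtain ⟨e₁, ha, hb⟩ := exists_perm_apply_pair h1 h1'
  have hπi : Equiv.prodCongr e₁ (Equiv.swap i.2 i'.2) i = i' := by
    rw [prodCongr_apply_mk, ha, Equiv.swap_apply_left]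
  have hπj : Equiv.prodCongr e₁ (Equiv.swap i.2 i'.2) j = j' := by
    rw [prodCongr_apply_mk, hb, ← h2, Equiv.swap_apply_left, h2']
  rw [apply_pair_eq_of_aut hfix _ (rook_adj_prodCongr hadj e₁ (Equiv.swap i.2 i'.2)) i j, hπi, hπj]

omit [Fintype α] [Fintype β] in
/-- **Column pairs form one class**. [folklore] -/
theorem colPair_eq
    (hadj : ∀ x y : α × β, G.Adj x y ↔ (x.1 ≠ y.1 ∧ x.2 = y.2) ∨ (x.1 = y.1 ∧ x.2 ≠ y.2))
    (hfix : ∀ π : α × β ≃ α × β, (∀ x y, G.Adj (π x) (π y) ↔ G.Adj x y) → ∀ σ, f (σ ∘ π) = f σ)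
    {i j i' j' : α × β} (h1 : i.1 = j.1) (h2 : i.2 ≠ j.2) (h1' : i'.1 = j'.1) (h2' : i'.2 ≠ j'.2) :
    f (Pi.single i 1 + Pi.single j 1) = f (Pi.single i' 1 + Pi.single j' 1) := by
  obtain ⟨e₂, ha, hb⟩ := exists_perm_apply_pair h2 h2'
  have hπi : Equiv.prodCongr (Equiv.swap i.1 i'.1) e₂ i = i' := by
    rw [prodCongr_apply_mk, ha, Equiv.swap_apply_left]
  have hπj : Equiv.prodCongr (Equiv.swap i.1 i'.1) e₂ j = j' := by
    rw [prodCongr_apply_mk, hb, ← h1, Equiv.swap_apply_left, h1']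
  rw [apply_pair_eq_of_aut hfix _ (rook_adj_prodCongr hadj (Equiv.swap i.1 i'.1) e₂) i j, hπi, hπj]

omit [Fintype α] [Fintype β] in
/-- **Far (non-adjacent) pairs form one class**. [folklore] -/
theorem farPair_eq
    (hadj : ∀ x y : α × β, G.Adj x y ↔ (x.1 ≠ y.1 ∧ x.2 = y.2) ∨ (x.1 = y.1 ∧ x.2 ≠ y.2))
    (hfix : ∀ π : α × β ≃ α × β, (∀ x y, G.Adj (π x) (π y) ↔ G.Adj x y) → ∀ σ, f (σ ∘ π) = f σ)
    {i j i' j' : α × β} (h1 : i.1 ≠ j.1) (h2 : i.2 ≠ j.2) (h1' : i'.1 ≠ j'.1) (h2' : i'.2 ≠ j'.2) :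
    f (Pi.single i 1 + Pi.single j 1) = f (Pi.single i' 1 + Pi.single j' 1) := by
  obtain ⟨e₁, ha, hb⟩ := exists_perm_apply_pair h1 h1'
  obtain ⟨e₂, hc, hd⟩ := exists_perm_apply_pair h2 h2'
  have hπi : Equiv.prodCongr e₁ e₂ i = i' := by rw [prodCongr_apply_mk, ha, hc]
  have hπj : Equiv.prodCongr e₁ e₂ j = j' := by rw [prodCongr_apply_mk, hb, hd]
  rw [apply_pair_eq_of_aut hfix _ (rook_adj_prodCongr hadj e₁ e₂) i j, hπi, hπj]

/-! ### Counting sums -/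

omit [DecidableEq β] [Fintype β] in
/-- `Σ_a [a ≠ u] c = (|α| − 1) c`. [folklore] -/
theorem sum_ite_eq_else (u : α) (c : ℂ) :
    (∑ a : α, if a = u then (0 : ℂ) else c) = ((Fintype.card α : ℂ) - 1) * c := by
  have h : ∀ a : α, (if a = u then (0 : ℂ) else c) = c - (if a = u then c else 0) := by
    intro a; split_ifs <;> ring
  simp_rw [h]
  rw [Finset.sum_sub_distrib, Finset.sum_const, Finset.card_univ, nsmul_eq_mul,
    Finset.sum_ite_eq' Finset.univ u, if_pos (Finset.mem_univ u)]
  ring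

omit [DecidableEq β] [Fintype β] in
/-- `Σ_a [a ∉ {u, v}] c = (|α| − 2) c` for `u ≠ v`. [folklore] -/
theorem sum_ite_or_eq_else {u v : α} (huv : u ≠ v) (c : ℂ) :
    (∑ a : α, if a = u ∨ a = v then (0 : ℂ) else c) = ((Fintype.card α : ℂ) - 2) * c := by
  have h : ∀ a : α, (if a = u ∨ a = v then (0 : ℂ) else c) =
      c - (if a = u then c else 0) - (if a = v then c else 0) := by
    intro a
    by_cases hu : a = u
    · subst hu; simp [huv]
    · by_cases hv : a = v
      · subst hv; simp [hu]
      · simp [hu, hv]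
  simp_rw [h]
  rw [Finset.sum_sub_distrib, Finset.sum_sub_distrib, Finset.sum_const, Finset.card_univ,
    nsmul_eq_mul, Finset.sum_ite_eq' Finset.univ u, if_pos (Finset.mem_univ u),
    Finset.sum_ite_eq' Finset.univ v, if_pos (Finset.mem_univ v)]
  ring

omit [DecidableEq β] [Fintype β] in
/-- `Σ_a [a ≠ u] (if a = v then b else c) = b + (|α| − 2) c` for `u ≠ v`. [folklore] -/
theorem sum_ite_eq_else_ite {u v : α} (huv : u ≠ v) (b c : ℂ) :
    (∑ a : α, if a = u then (0 : ℂ) else if a = v then b else c) =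
      b + ((Fintype.card α : ℂ) - 2) * c := by
  have h : ∀ a : α, (if a = u then (0 : ℂ) else if a = v then b else c) =
      (if a = u ∨ a = v then (0 : ℂ) else c) + (if a = v then b else 0) := by
    intro a
    by_cases hu : a = u
    · subst hu; simp [huv]
    · by_cases hv : a = v
      · subst hv; simp [hu]
      · simp [hu, hv]
  simp_rw [h]
  rw [Finset.sum_add_distrib, sum_ite_or_eq_else huv, Finset.sum_ite_eq' Finset.univ v,
    if_pos (Finset.mem_univ v)]
  ring

/-! ### Neighbour sums on the rook graph -/

variable [DecidableRel G.Adj]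

omit [DecidableEq α] [DecidableEq β] in
/-- **Neighbour sum on the rook graph**: the neighbours of `x = (a₀, b₀)` are the `(a, b₀)`,
`a ≠ a₀`, and the `(a₀, b)`, `b ≠ b₀`. [folklore] -/
theorem rook_sum_adj [DecidableEq α] [DecidableEq β]
    (hadj : ∀ x y : α × β, G.Adj x y ↔ (x.1 ≠ y.1 ∧ x.2 = y.2) ∨ (x.1 = y.1 ∧ x.2 ≠ y.2))
    (x : α × β) (g : α × β → ℂ) :
    (∑ y, if G.Adj x y then g y else 0) =
      (∑ a, if a = x.1 then 0 else g (a, x.2)) + ∑ b, if b = x.2 then 0 else g (x.1, b) := by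
  rw [Fintype.sum_prod_type]
  have inner : ∀ a : α, (∑ b : β, if G.Adj x (a, b) then g (a, b) else 0) =
      (if a = x.1 then (0 : ℂ) else g (a, x.2))
        + (if a = x.1 then ∑ b, (if b = x.2 then 0 else g (x.1, b)) else 0) := by
    intro a
    by_cases ha : a = x.1
    · subst ha
      rw [if_pos rfl, if_pos rfl, zero_add]
      refine Finset.sum_congr rfl fun b _ => ?_
      have hb : G.Adj x (x.1, b) ↔ ¬ b = x.2 := by
        rw [hadj]
        simp only [ne_eq, not_true_eq_false, false_and, false_or, true_and]
        exact ⟨fun h h' => h h'.symm, fun h h' => h h'.symm⟩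
      by_cases hb' : b = x.2
      · rw [if_neg (fun h => (hb.mp h) hb'), if_pos hb']
      · rw [if_pos (hb.mpr hb'), if_neg hb']
    · rw [if_neg ha, if_neg ha, add_zero]
      have hb : ∀ b, G.Adj x (a, b) ↔ b = x.2 := by
        intro b
        rw [hadj]
        simp only [ne_eq]
        constructor
        · rintro (⟨-, h⟩ | ⟨h, -⟩)
          · exact h.symm
          · exact absurd h.symm ha
        · intro h
          exact Or.inl ⟨fun h' => ha h'.symm, h.symm⟩
      simp_rw [hb]
      rw [Finset.sum_ite_eq' Finset.univ x.2, if_pos (Finset.mem_univ _)]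
  simp_rw [inner]
  rw [Finset.sum_add_distrib, Finset.sum_ite_eq' Finset.univ x.1, if_pos (Finset.mem_univ _)]

omit [Fintype α] [DecidableEq α] [Fintype β] [DecidableEq β] [DecidableRel G.Adj] in
/-- The "exactly one endpoint moves" double sum of `xxz_mulVec_pair`, reduced by symmetry to the
two neighbour sums at `i` and at `j` (any finite graph). [folklore] -/
theorem hopSum_eq_two_mul {V : Type*} [Fintype V] [DecidableEq V] (G : SimpleGraph V)
    [DecidableRel G.Adj] (f : (V → Fin 2) → ℂ) {i j : V} (hij : i ≠ j) :
    (∑ x, ∑ y, (if G.Adj x y then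
        (if ((x = i ∨ x = j) ∧ ¬ (y = i ∨ y = j) ∨ ¬ (x = i ∨ x = j) ∧ (y = i ∨ y = j)) then
          f (Pi.single (Equiv.swap x y i) 1 + Pi.single (Equiv.swap x y j) 1) else 0) else 0)) =
      2 * ((∑ y, if y = i ∨ y = j then 0 else
              if G.Adj i y then f (Pi.single y 1 + Pi.single j 1) else 0)
           + (∑ y, if y = i ∨ y = j then 0 else
              if G.Adj j y then f (Pi.single i 1 + Pi.single y 1) else 0)) := by
  -- the half with `x ∈ {i, j}`, `y ∉ {i, j}`
  set F₁ : V → V → ℂ := fun x y => if (x = i ∨ x = j) ∧ ¬ (y = i ∨ y = j) then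
      (if G.Adj x y then f (Pi.single (Equiv.swap x y i) 1 + Pi.single (Equiv.swap x y j) 1) else 0)
    else 0 with hF₁
  have hsplit : ∀ x y, (if G.Adj x y then
        (if ((x = i ∨ x = j) ∧ ¬ (y = i ∨ y = j) ∨ ¬ (x = i ∨ x = j) ∧ (y = i ∨ y = j)) then
          f (Pi.single (Equiv.swap x y i) 1 + Pi.single (Equiv.swap x y j) 1) else 0) else 0)
      = F₁ x y + F₁ y x := by
    intro x y
    simp only [hF₁]
    rw [Equiv.swap_comm y x]
    by_cases hxy : G.Adj x y
    · have hyx : G.Adj y x := hxy.symm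
      rw [if_pos hxy, if_pos hxy, if_pos hyx]
      by_cases hx : (x = i ∨ x = j)
      · by_cases hy : (y = i ∨ y = j)
        · simp [hx, hy]
        · simp [hx, hy]
      · by_cases hy : (y = i ∨ y = j)
        · simp [hx, hy]
        · simp [hx, hy]
    · have hyx : ¬ G.Adj y x := fun h => hxy h.symm
      rw [if_neg hxy, if_neg hxy, if_neg hyx]
      simp
  simp_rw [hsplit]
  rw [Finset.sum_congr rfl fun x _ => Finset.sum_add_distrib (s := Finset.univ)
      (f := fun y => F₁ x y) (g := fun y => F₁ y x), Finset.sum_add_distrib,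
    Finset.sum_comm (f := fun x y => F₁ y x), ← two_mul]
  congr 1
  -- only `x = i` and `x = j` contribute
  rw [Fintype.sum_eq_add i j hij]
  · congr 1
    · refine Finset.sum_congr rfl fun y _ => ?_
      simp only [hF₁, true_or, true_and]
      by_cases hy : (y = i ∨ y = j)
      · rw [if_neg (not_not_intro hy), if_pos hy]
      · rw [if_pos hy, if_neg hy]
        have hyi : y ≠ i := fun h => hy (Or.inl h)
        have hyj : y ≠ j := fun h => hy (Or.inr h)
        rw [Equiv.swap_apply_left, Equiv.swap_apply_of_ne_of_ne hij.symm hyj.symm]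
    · refine Finset.sum_congr rfl fun y _ => ?_
      simp only [hF₁, or_true, true_and]
      by_cases hy : (y = i ∨ y = j)
      · rw [if_neg (not_not_intro hy), if_pos hy]
      · rw [if_pos hy, if_neg hy]
        have hyi : y ≠ i := fun h => hy (Or.inl h)
        have hyj : y ≠ j := fun h => hy (Or.inr h)
        rw [Equiv.swap_apply_left, Equiv.swap_apply_of_ne_of_ne hij hyi.symm]
  · intro x hx
    refine Finset.sum_eq_zero fun y _ => ?_
    simp only [hF₁]
    rw [if_neg]
    push Not
    intro h
    exact absurd h (not_or.mpr hx)

end Rook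

/-! ### Sums over ordered pairs by class -/

/-- **Sum over ordered pairs of distinct sites by class**: if `h i j` equals `a` on row pairs, `b`
on column pairs and `c` on far pairs, then
`Σ_i Σ_{j ≠ i} h i j = |α||β|·((|α|−1) a + (|β|−1) b + (|α|−1)(|β|−1) c)`. [folklore] -/
theorem sum_pairs_of_classes (h : α × β → α × β → ℂ) {a b c : ℂ}
    (ha : ∀ x y : α × β, x.1 ≠ y.1 → x.2 = y.2 → h x y = a)
    (hb : ∀ x y : α × β, x.1 = y.1 → x.2 ≠ y.2 → h x y = b)
    (hc : ∀ x y : α × β, x.1 ≠ y.1 → x.2 ≠ y.2 → h x y = c) :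
    (∑ i : α × β, ∑ j : α × β, if i = j then 0 else h i j) =
      (Fintype.card α : ℂ) * (Fintype.card β : ℂ) *
        (((Fintype.card α : ℂ) - 1) * a + ((Fintype.card β : ℂ) - 1) * b
          + ((Fintype.card α : ℂ) - 1) * ((Fintype.card β : ℂ) - 1) * c) := by
  have inner : ∀ i : α × β, (∑ j : α × β, if i = j then 0 else h i j) =
      ((Fintype.card α : ℂ) - 1) * a + ((Fintype.card β : ℂ) - 1) * b
        + ((Fintype.card α : ℂ) - 1) * ((Fintype.card β : ℂ) - 1) * c := by
    intro i
    rw [Fintype.sum_prod_type]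
    have row : ∀ x : α, (∑ y : β, if i = (x, y) then (0 : ℂ) else h i (x, y)) =
        (if x = i.1 then (0 : ℂ) else a + ((Fintype.card β : ℂ) - 1) * c)
          + (if x = i.1 then ((Fintype.card β : ℂ) - 1) * b else 0) := by
      intro x
      by_cases hx : x = i.1
      · subst hx
        rw [if_pos rfl, if_pos rfl, zero_add]
        have e : ∀ y : β, (if i = (i.1, y) then (0 : ℂ) else h i (i.1, y)) =
            if y = i.2 then 0 else b := by
          intro y
          by_cases hy : y = i.2
          · subst hy; simp
          · have : i ≠ (i.1, y) := fun h' => hy (by rw [h'])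
            rw [if_neg this, if_neg hy]
            exact hb _ _ rfl (fun h' => hy h'.symm)
        simp_rw [e]
        exact sum_ite_eq_else i.2 b
      · rw [if_neg hx, if_neg hx, add_zero]
        have e : ∀ y : β, (if i = (x, y) then (0 : ℂ) else h i (x, y)) =
            (if y = i.2 then a else 0) + (if y = i.2 then 0 else c) := by
          intro y
          have : i ≠ (x, y) := fun h' => hx (by rw [h'])
          rw [if_neg this]
          by_cases hy : y = i.2
          · subst hy
            rw [if_pos rfl, if_pos rfl, add_zero]
            exact ha _ _ (fun h' => hx h'.symm) rfl
          · rw [if_neg hy, if_neg hy, zero_add]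
            exact hc _ _ (fun h' => hx h'.symm) (fun h' => hy h'.symm)
        simp_rw [e]
        rw [Finset.sum_add_distrib, Finset.sum_ite_eq' Finset.univ i.2, if_pos (Finset.mem_univ _),
          sum_ite_eq_else i.2 c]
    simp_rw [row]
    rw [Finset.sum_add_distrib, sum_ite_eq_else i.1, Finset.sum_ite_eq' Finset.univ i.1,
      if_pos (Finset.mem_univ _)]
    ring
  simp_rw [inner]
  rw [Finset.sum_const, Finset.card_univ, Fintype.card_prod, nsmul_eq_mul]
  push_cast
  ring

end Summit.HubbardSuperconductivity.HubbardSuperconductivity.Theorems.AnisotropyChord.TwoMagnon
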